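import Summits.CriticalPhenomena.PercolationContinuityZ3.Theorems.PercNearOneGluingNoHeavyLowerTailThreePointProductFormFibreParallelWalks
import HarnessLib

/-!
# Parallel composition at the three terminals, II: the six events split pointwise (Sahi programme, prover prim-sahi-p2 gen 59)

Support file (`--supports stmt-CriticalPhenomena-4575`, helper); continues `…ThreePointProductFormFibreParallelWalks` (same gen).
Standard axioms, no sorries, no named facts, no definitions.  Memo `run/shared/lean/prim/prim-sahi/FROM-prim-sahi-p2-gen59-ONE-STEP-LEMMA.md`
§3, §8(2); `prim-sahi-p2/PROOF-E3.md` (63h), (63k), §69.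

A PIECE is a label class `Q` (other labels are read as closed: `z|_Q = fun l => z l && decide (Q l)`); its six statistics w.r.t. the
terminals `(s, a, c)` are the numbers of configurations `z` with, for `x = z|_Q` and the restricted flat `(♭x)|_Q`
(`♭x = clusterFlip ends a x̄`):
`S0: s, c isolated in x`; `S0∪P1: c isolated`; `S0∪P2: s isolated`; `Ga: S0 ∧ c isolated in (♭x)|_Q`; `Gb: S0 ∧ s isolated in (♭x)|_Q`;
`G1: S0 ∧ both isolated in (♭x)|_Q` ('isolated' = from the other two terminals).  `#bad = #S0 − Ga − Gb + G1` (gen 53 (63k): `bad = H + B − C − D`).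
THIS FILE (pointwise half): if `Q₁, Q₂` are label classes living on disjoint terminal-free vertex classes `P₁, P₂` (`Qᵢ`-labels have
endpoints in `Pᵢ ∪ {s,a,c}`), then for `x = z|_{Q₁∪Q₂}` each of the six events is the conjunction of the same events for `z|_{Q₁}` and
`z|_{Q₂}` (`events_split`; walk splitting and flat locality of part I).  The counting half (`card_parallel_*`: the statistics multiply) is
the companion `…ThreePointProductFormFibreParallelCounts`.
[this work] (gen 59).
-/

namespace Summit.CriticalPhenomena.PercolationContinuityZ3.Theorems.ProductFormFibre

open Finset Literature.Probability.Percolation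
open Summit.CriticalPhenomena.PercolationContinuityZ3.Theorems.ThreePointCPIClusterSwap (clusterFlip)

variable {V α : Type*}

section Pointwise

variable (ends : α → Sym2 V) (s a c : V) (P₁ P₂ : V → Prop) (Q₁ Q₂ : α → Prop)

/-- Open labels of a configuration supported on `Q₁ ∪ Q₂`: a label at a `P₁`-vertex is a `Q₁`-label. [this work] -/
theorem label_class_of_vertex₁
    (hQP₂ : ∀ l, Q₂ l → ∀ v ∈ ends l, P₂ v ∨ (v = s ∨ v = a ∨ v = c))
    (hPT₁ : ∀ v, P₁ v → ¬ (v = s ∨ v = a ∨ v = c)) (hP : ∀ v, P₁ v → ¬ P₂ v)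
    (y : α → Bool) (hy : ∀ l, y l = true → Q₁ l ∨ Q₂ l) :
    ∀ l, y l = true → ∀ x ∈ ends l, P₁ x → Q₁ l := by
  intro l hl x hx hPx
  rcases hy l hl with h | h
  · exact h
  · rcases hQP₂ l h x hx with h2 | h2
    · exact absurd h2 (hP x hPx)
    · exact absurd h2 (hPT₁ x hPx)

/-- Symmetric statement for `P₂`. [this work] -/
theorem label_class_of_vertex₂
    (hQP₁ : ∀ l, Q₁ l → ∀ v ∈ ends l, P₁ v ∨ (v = s ∨ v = a ∨ v = c))
    (hPT₂ : ∀ v, P₂ v → ¬ (v = s ∨ v = a ∨ v = c)) (hP : ∀ v, P₁ v → ¬ P₂ v)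
    (y : α → Bool) (hy : ∀ l, y l = true → Q₁ l ∨ Q₂ l) :
    ∀ l, y l = true → ∀ x ∈ ends l, P₂ x → Q₂ l := by
  intro l hl x hx hPx
  rcases hy l hl with h | h
  · rcases hQP₁ l h x hx with h2 | h2
    · exact absurd hPx (hP x h2)
    · exact absurd h2 (hPT₂ x hPx)
  · exact h

variable [DecidablePred Q₁] [DecidablePred Q₂]

/-- **Isolation splits.**  For a configuration `y` supported on `Q₁ ∪ Q₂`, a terminal `t₁` is isolated from the other two terminals in `y`
iff it is so in `y|_{Q₁}` and in `y|_{Q₂}`. [this work] -/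
theorem isolated_iff_restrict
    (hQP₁ : ∀ l, Q₁ l → ∀ v ∈ ends l, P₁ v ∨ (v = s ∨ v = a ∨ v = c))
    (hQP₂ : ∀ l, Q₂ l → ∀ v ∈ ends l, P₂ v ∨ (v = s ∨ v = a ∨ v = c))
    (hPT₁ : ∀ v, P₁ v → ¬ (v = s ∨ v = a ∨ v = c)) (hPT₂ : ∀ v, P₂ v → ¬ (v = s ∨ v = a ∨ v = c))
    (hP : ∀ v, P₁ v → ¬ P₂ v)
    (y : α → Bool) (hy : ∀ l, y l = true → Q₁ l ∨ Q₂ l)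
    {t₁ t₂ t₃ : V} (ht₁ : t₁ = s ∨ t₁ = a ∨ t₁ = c) (ht₂ : t₂ = s ∨ t₂ = a ∨ t₂ = c) (ht₃ : t₃ = s ∨ t₃ = a ∨ t₃ = c)
    (hT : ∀ t, (t = s ∨ t = a ∨ t = c) → t ≠ t₁ → t = t₂ ∨ t = t₃) :
    (¬ (openGraph (labelledOpen ends y)).Reachable t₁ t₂ ∧ ¬ (openGraph (labelledOpen ends y)).Reachable t₁ t₃) ↔
    ((¬ (openGraph (labelledOpen ends fun l => y l && decide (Q₁ l))).Reachable t₁ t₂ ∧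
       ¬ (openGraph (labelledOpen ends fun l => y l && decide (Q₁ l))).Reachable t₁ t₃) ∧
     (¬ (openGraph (labelledOpen ends fun l => y l && decide (Q₂ l))).Reachable t₁ t₂ ∧
       ¬ (openGraph (labelledOpen ends fun l => y l && decide (Q₂ l))).Reachable t₁ t₃)) :=
  isolated_iff_sides ends s a c P₁ P₂ Q₁ Q₂ y (fun l => y l && decide (Q₁ l)) (fun l => y l && decide (Q₂ l))
    (label_class_of_vertex₁ ends s a c P₁ P₂ Q₁ Q₂ hQP₂ hPT₁ hP y hy) hQP₁ hPT₁
    (label_class_of_vertex₂ ends s a c P₁ P₂ Q₁ Q₂ hQP₁ hPT₂ hP y hy) hQP₂ hPT₂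
    hy (fun l hl h => by simp [h, hl]) (fun l hl h => by simp [h, hl])
    (fun l h => by simp only [Bool.and_eq_true] at h; exact h.1) (fun l h => by simp only [Bool.and_eq_true] at h; exact h.1)
    ht₁ ht₂ ht₃ hT

omit [DecidablePred Q₂] in
/-- **The restricted flat agrees on `Q₁` with the restricted flat of the `Q₁`-part** (for `a` isolated from `s, c` in `y`, and
open labels at `P₁`-vertices in `Q₁`). [this work] -/
theorem flat_restrict_eq [DecidableEq V]
    (hQP₁ : ∀ l, Q₁ l → ∀ v ∈ ends l, P₁ v ∨ (v = s ∨ v = a ∨ v = c))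
    (hPT₁ : ∀ v, P₁ v → ¬ (v = s ∨ v = a ∨ v = c))
    (y : α → Bool) (hy₁ : ∀ l, y l = true → ∀ x ∈ ends l, P₁ x → Q₁ l)
    (has : ¬ (openGraph (labelledOpen ends y)).Reachable a s) (hac : ¬ (openGraph (labelledOpen ends y)).Reachable a c) :
    (fun l => clusterFlip ends a (fun x => !y x) l && decide (Q₁ l)) =
      (fun l => clusterFlip ends a (fun x => !(y x && decide (Q₁ x))) l && decide (Q₁ l)) := by
  funext l
  by_cases hl : Q₁ l
  · have := flat_eq_of_side ends s a c P₁ Q₁ y (fun l => y l && decide (Q₁ l)) hy₁ hQP₁ hPT₁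
      (fun l hl h => by simp [h, hl]) (fun l h => by simp only [Bool.and_eq_true] at h; exact h.1)
      (fun l hl => by simp [hl]) has hac hl
    rw [this]
  · simp [hl]

/-- Restricting `z|_{Q₁∪Q₂}` further to `Qᵢ` is `z|_{Qᵢ}`; and `z|_{Q₁∪Q₂}` is supported on `Q₁ ∪ Q₂`. (Bookkeeping.) [this work] -/
theorem restrict_restrict (z : α → Bool) :
    ((fun l => (z l && decide (Q₁ l ∨ Q₂ l)) && decide (Q₁ l)) = fun l => z l && decide (Q₁ l)) ∧
    ((fun l => (z l && decide (Q₁ l ∨ Q₂ l)) && decide (Q₂ l)) = fun l => z l && decide (Q₂ l)) ∧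
    (∀ l, (z l && decide (Q₁ l ∨ Q₂ l)) = true → Q₁ l ∨ Q₂ l) := by
  refine ⟨?_, ?_, ?_⟩
  · funext l; by_cases h1 : Q₁ l <;> simp [h1]
  · funext l; by_cases h2 : Q₂ l <;> simp [h2]
  · intro l hl
    simp only [Bool.and_eq_true, decide_eq_true_eq] at hl
    exact hl.2

/-- **The six events split pointwise.**  For `x = z|_{Q₁∪Q₂}`, `xᵢ = z|_{Qᵢ}` and the restricted flats `F = (♭x)|_{Q₁∪Q₂}`,
`Fᵢ = (♭xᵢ)|_{Qᵢ}`: `S0(x) ↔ S0(x₁) ∧ S0(x₂)`, `isoC(x) ↔ isoC(x₁) ∧ isoC(x₂)`, `isoS` likewise, and under `S0(x)`: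
`isoC(F) ↔ isoC(F₁) ∧ isoC(F₂)`, `isoS(F) ↔ isoS(F₁) ∧ isoS(F₂)`. [this work] -/
theorem events_split [DecidableEq V]
    (hQP₁ : ∀ l, Q₁ l → ∀ v ∈ ends l, P₁ v ∨ (v = s ∨ v = a ∨ v = c))
    (hQP₂ : ∀ l, Q₂ l → ∀ v ∈ ends l, P₂ v ∨ (v = s ∨ v = a ∨ v = c))
    (hPT₁ : ∀ v, P₁ v → ¬ (v = s ∨ v = a ∨ v = c)) (hPT₂ : ∀ v, P₂ v → ¬ (v = s ∨ v = a ∨ v = c))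
    (hP : ∀ v, P₁ v → ¬ P₂ v) (z : α → Bool) :
    let x : α → Bool := fun l => z l && decide (Q₁ l ∨ Q₂ l)
    let x₁ : α → Bool := fun l => z l && decide (Q₁ l)
    let x₂ : α → Bool := fun l => z l && decide (Q₂ l)
    let F : α → Bool := fun l => clusterFlip ends a (fun y => !x y) l && decide (Q₁ l ∨ Q₂ l)
    let F₁ : α → Bool := fun l => clusterFlip ends a (fun y => !x₁ y) l && decide (Q₁ l)
    let F₂ : α → Bool := fun l => clusterFlip ends a (fun y => !x₂ y) l && decide (Q₂ l)
    ((¬ (openGraph (labelledOpen ends x)).Reachable s a ∧ ¬ (openGraph (labelledOpen ends x)).Reachable s c) ↔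
      ((¬ (openGraph (labelledOpen ends x₁)).Reachable s a ∧ ¬ (openGraph (labelledOpen ends x₁)).Reachable s c) ∧
       (¬ (openGraph (labelledOpen ends x₂)).Reachable s a ∧ ¬ (openGraph (labelledOpen ends x₂)).Reachable s c))) ∧
    ((¬ (openGraph (labelledOpen ends x)).Reachable c a ∧ ¬ (openGraph (labelledOpen ends x)).Reachable c s) ↔
      ((¬ (openGraph (labelledOpen ends x₁)).Reachable c a ∧ ¬ (openGraph (labelledOpen ends x₁)).Reachable c s) ∧
       (¬ (openGraph (labelledOpen ends x₂)).Reachable c a ∧ ¬ (openGraph (labelledOpen ends x₂)).Reachable c s))) ∧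
    (((¬ (openGraph (labelledOpen ends x)).Reachable s a ∧ ¬ (openGraph (labelledOpen ends x)).Reachable s c) ∧
      (¬ (openGraph (labelledOpen ends x)).Reachable c a ∧ ¬ (openGraph (labelledOpen ends x)).Reachable c s)) →
     (((¬ (openGraph (labelledOpen ends F)).Reachable s a ∧ ¬ (openGraph (labelledOpen ends F)).Reachable s c) ↔
       ((¬ (openGraph (labelledOpen ends F₁)).Reachable s a ∧ ¬ (openGraph (labelledOpen ends F₁)).Reachable s c) ∧
        (¬ (openGraph (labelledOpen ends F₂)).Reachable s a ∧ ¬ (openGraph (labelledOpen ends F₂)).Reachable s c))) ∧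
      ((¬ (openGraph (labelledOpen ends F)).Reachable c a ∧ ¬ (openGraph (labelledOpen ends F)).Reachable c s) ↔
       ((¬ (openGraph (labelledOpen ends F₁)).Reachable c a ∧ ¬ (openGraph (labelledOpen ends F₁)).Reachable c s) ∧
        (¬ (openGraph (labelledOpen ends F₂)).Reachable c a ∧ ¬ (openGraph (labelledOpen ends F₂)).Reachable c s))))) := by
  intro x x₁ x₂ F F₁ F₂
  obtain ⟨e1, e2, hsupp⟩ := restrict_restrict Q₁ Q₂ z
  have hTs : ∀ t, (t = s ∨ t = a ∨ t = c) → t ≠ s → t = a ∨ t = c := fun t ht hne => by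
    rcases ht with h | h | h; exact absurd h hne; exact Or.inl h; exact Or.inr h
  have hTc : ∀ t, (t = s ∨ t = a ∨ t = c) → t ≠ c → t = a ∨ t = s := fun t ht hne => by
    rcases ht with h | h | h; exact Or.inr h; exact Or.inl h; exact absurd h hne
  have hs := isolated_iff_restrict ends s a c P₁ P₂ Q₁ Q₂ hQP₁ hQP₂ hPT₁ hPT₂ hP x hsupp
    (t₁ := s) (t₂ := a) (t₃ := c) (Or.inl rfl) (Or.inr (Or.inl rfl)) (Or.inr (Or.inr rfl)) hTs
  have hc := isolated_iff_restrict ends s a c P₁ P₂ Q₁ Q₂ hQP₁ hQP₂ hPT₁ hPT₂ hP x hsupp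
    (t₁ := c) (t₂ := a) (t₃ := s) (Or.inr (Or.inr rfl)) (Or.inr (Or.inl rfl)) (Or.inl rfl) hTc
  simp only [x] at hs hc
  rw [e1, e2] at hs hc
  refine ⟨hs, hc, fun hS0 => ?_⟩
  -- the flat: `F` is supported on `Q₁ ∪ Q₂`, and its restrictions are `F₁`, `F₂`
  have hFsupp : ∀ l, F l = true → Q₁ l ∨ Q₂ l := fun l hl => by
    simp only [F, Bool.and_eq_true, decide_eq_true_eq] at hl; exact hl.2
  have has : ¬ (openGraph (labelledOpen ends x)).Reachable a s := fun h => hS0.1.1 h.symm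
  have hac : ¬ (openGraph (labelledOpen ends x)).Reachable a c := fun h => hS0.2.1 h.symm
  have hx1 : ∀ l, x l = true → ∀ v ∈ ends l, P₁ v → Q₁ l := label_class_of_vertex₁ ends s a c P₁ P₂ Q₁ Q₂ hQP₂ hPT₁ hP x hsupp
  have hx2 : ∀ l, x l = true → ∀ v ∈ ends l, P₂ v → Q₂ l := label_class_of_vertex₂ ends s a c P₁ P₂ Q₁ Q₂ hQP₁ hPT₂ hP x hsupp
  have hF1 : (fun l => F l && decide (Q₁ l)) = F₁ := by
    have h := flat_restrict_eq ends s a c P₁ Q₁ hQP₁ hPT₁ x hx1 has hac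
    have hxe : (fun y => !(x y && decide (Q₁ y))) = (fun y => !(x₁ y)) := by
      funext y; simp only [x, x₁]; by_cases h1 : Q₁ y <;> simp [h1]
    rw [hxe] at h
    funext l
    have hl := congrFun h l
    simp only [F, F₁]
    by_cases h1 : Q₁ l
    · simpa [h1] using hl
    · simp [h1]
  have hF2 : (fun l => F l && decide (Q₂ l)) = F₂ := by
    have h := flat_restrict_eq ends s a c P₂ Q₂ hQP₂ hPT₂ x hx2 has hac
    have hxe : (fun y => !(x y && decide (Q₂ y))) = (fun y => !(x₂ y)) := by
      funext y; simp only [x, x₂]; by_cases h2 : Q₂ y <;> simp [h2]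
    rw [hxe] at h
    funext l
    have hl := congrFun h l
    simp only [F, F₂]
    by_cases h2 : Q₂ l
    · simpa [h2] using hl
    · simp [h2]
  have hFs := isolated_iff_restrict ends s a c P₁ P₂ Q₁ Q₂ hQP₁ hQP₂ hPT₁ hPT₂ hP F hFsupp
    (t₁ := s) (t₂ := a) (t₃ := c) (Or.inl rfl) (Or.inr (Or.inl rfl)) (Or.inr (Or.inr rfl)) hTs
  have hFc := isolated_iff_restrict ends s a c P₁ P₂ Q₁ Q₂ hQP₁ hQP₂ hPT₁ hPT₂ hP F hFsupp
    (t₁ := c) (t₂ := a) (t₃ := s) (Or.inr (Or.inr rfl)) (Or.inr (Or.inl rfl)) (Or.inl rfl) hTc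
  rw [hF1, hF2] at hFs hFc
  exact ⟨hFs, hFc⟩

end Pointwise

end Summit.CriticalPhenomena.PercolationContinuityZ3.Theorems.ProductFormFibre
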